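import Summits.CriticalPhenomena.PercolationContinuityZ3.Theorems.Transplant.SkelNegBParamsSched
import Summits.CriticalPhenomena.PercolationContinuityZ3.Theorems.Transplant.SkelNegBParamsFineSizeA
import HarnessLib

/-!
# N1 params, chain of record `NegB`, part Sched-A — the (ζ′) twin of part Sched (p28xxxx) at `A := Aof κ = 20·K`: THE COLUMN SLOT AND FIBRE SCHEDULE OF THE (ζ′) CELLS
# (**`offNA w := NrepA (cen w) + 1`**, **`schedOfA S := Prm.schedN S fcellsA offNA`** + `WFS2`/column floor — today's `offN/schedOf` live in `SkelNegBChoiceAll`; the A twins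
# live HERE so that the (C)/(F) columns have them before the choice function), THE LATTICE RECORD **`NegB.prFA : FinePrm := ⟨A, n_L, h_L, v_L, v_β, 20K·s₀, 20K·s₁, D_A⟩`**
# (`prFA.ψ φ′ t = NegB.fineA … φ′` by `rfl`; `prFA.c_i = A·s_i`), the exact representative at a cell centre, and THE LINEAR COLUMN BOUND
# **`offNA x ≤ cOffA·‖x‖₁ + 1`**, **`cOffA := A·(ℓ_L + 21·n_L + 1)`** (stmt-g16 2026-08-22; NEG-SCOPE §B.19 (ζ′))
builds on p205010 (kernel theorem, internal audit signed; external expert review pending) — nothing in this file uses p205010; NOTHING is claimed about the node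
`SamePDropOfSkeletonNeg₁` (OPEN).
Lane `prim-bschramm-*`, seat `prim-bschramm-stmt` (gen 16); helper file (`--supports stmt-CriticalPhenomena-4575 --as helper`); ledger HOME/prim-bschramm-stmt/NEG-PARAMS.md.
* §1 **`offNA`**, **`schedOfA`**, `schedOfA_WFS2`, `colQ_schedOfA`; §2 **`prFA`**, `prFA_fields`, **`prFA_ψ`**, `prFA_D`, `prFA_c_pos`, **`prFA_c_eq`** (`c_i = A·s_i`), **`cOffA`**,
  `rep₂_cenA_at`, `NrepA_cen_le`, **`offNA_le`**, **`hoffNA_at`**, `prFA_room`.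
[cite: KozmaNitzan2024, §4 pp. 25–26; Lemma 12 (p. 24)] [cite: MartineauTassion2017, §4.3]
-/

noncomputable section

open scoped Classical

namespace Summit.CriticalPhenomena.PercolationContinuityZ3.Theorems.Transplant

open Literature.Probability.LatticeModels

namespace PlanarSkeletonNeg

namespace NegB

open SkelConc (Consts)
open BoxProdZ2 (ConcRadiiG)
open Neg

section Sched

variable (κ : Consts) {V : Type} [DecidableEq V] [Countable V] {G : SimpleGraph V} [G.LocallyFinite] (Φ : PlanarSkeletonNeg G) (t : V)
  (p : unitInterval) (D : Skelφ.StepI.DataN V) (g f : ℕ)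

/-! ## §1 The column slot and the fibre schedule of the (ζ′) cells -/

/-- **The column slot of record of the (ζ′) chain**: `offNA w := NrepA (cen w) + 1`. [this work] -/
def offNA : Site 2 → ℕ := fun w => NrepA κ Φ t p D g f ((fcellsA κ Φ t p D g f).cen w) + 1

/-- **THE FIBRE SCHEDULE OF RECORD OF THE (ζ′) CHAIN** from the q-level inputs `S`: `Prm.schedN S fcellsA offNA`. [cite: KozmaNitzan2024, §4 pp. 25–26; Lemma 12 (p. 24)] -/
def schedOfA (S : Skelφ.Prm.SchedIn) : ConcRadiiG := Skelφ.Prm.schedN S (fcellsA κ Φ t p D g f) (offNA κ Φ t p D g f)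

/-- **`WFS2 fcellsA (schedOfA S)`** for every input block. [this work] -/
theorem schedOfA_WFS2 (S : Skelφ.Prm.SchedIn) : Skelφ.WFS2 (fcellsA κ Φ t p D g f) (schedOfA κ Φ t p D g f S) := Skelφ.Prm.schedN_WFS2 _ _ _

/-- **The column floor**: `NrepA (cen x) + 1 ≤ rQ a x` at every `(a, x)`. [this work] -/
theorem colQ_schedOfA (S : Skelφ.Prm.SchedIn) : ∀ a x, NrepA κ Φ t p D g f ((fcellsA κ Φ t p D g f).cen x) + 1 ≤ (schedOfA κ Φ t p D g f S).rQ a x :=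
  fun a x => Skelφ.Prm.off_le_schedN_rQ S (fcellsA κ Φ t p D g f) (offNA κ Φ t p D g f) a x

/-! ## §2 The lattice record of the (ζ′) cells and the linear column bound -/

/-- **THE LATTICE RECORD OF RECORD OF THE (ζ′) CHAIN** `prFA := ⟨A, n_L, h_L, v_L, v_β, 20K·s₀, 20K·s₁, D_A⟩` (hp-8's `FinePrm`; `prFA.ψ φ′ t = NegB.fineA … φ′`). [this work] -/
def prFA : Skelφ.FinePrm where
  A := Aof κ
  n := nL κ Φ t p D g f
  h := hL κ Φ t p D g f
  vα := vL κ Φ t p D g f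
  vβ := vβL κ Φ t p D g f
  c₀ := 20 * ((fcellsA κ Φ t p D g f).K : ℤ) * (((fcellsA κ Φ t p D g f).s 0 : ℕ) : ℤ)
  c₁ := 20 * ((fcellsA κ Φ t p D g f).K : ℤ) * (((fcellsA κ Φ t p D g f).s 1 : ℕ) : ℤ)
  D := Skelφ.NegPrm.DofA (Aof κ) (nL κ Φ t p D g f) (hL κ Φ t p D g f) (ℓL κ Φ t p D g f) (vL κ Φ t p D g f)

/-- The fields of `prFA` by `rfl`. [folklore] -/
theorem prFA_fields :
    (prFA κ Φ t p D g f).A = Aof κ ∧ (prFA κ Φ t p D g f).n = nL κ Φ t p D g f ∧ (prFA κ Φ t p D g f).h = hL κ Φ t p D g f ∧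
      (prFA κ Φ t p D g f).vα = vL κ Φ t p D g f ∧ (prFA κ Φ t p D g f).vβ = vβL κ Φ t p D g f ∧
      (prFA κ Φ t p D g f).c₀ = 20 * ((fcellsA κ Φ t p D g f).K : ℤ) * (((fcellsA κ Φ t p D g f).s 0 : ℕ) : ℤ) ∧
      (prFA κ Φ t p D g f).c₁ = 20 * ((fcellsA κ Φ t p D g f).K : ℤ) * (((fcellsA κ Φ t p D g f).s 1 : ℕ) : ℤ) ∧
      (prFA κ Φ t p D g f).D = Skelφ.NegPrm.DofA (Aof κ) (nL κ Φ t p D g f) (hL κ Φ t p D g f) (ℓL κ Φ t p D g f) (vL κ Φ t p D g f) :=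
  ⟨rfl, rfl, rfl, rfl, rfl, rfl, rfl, rfl⟩

/-- **`prFA.ψ φ′ t = NegB.fineA … φ′`** (the (F) files' cell map IS the fine window map of record). [folklore] -/
theorem prFA_ψ (φ' : V → Site 2) : (prFA κ Φ t p D g f).ψ φ' t = fineA κ Φ t p D g f φ' := rfl

/-- `prFA.D = detD prFA.A prFA.n prFA.h prFA.vα prFA.vβ` (the determinant slot is the true determinant). [folklore] -/
theorem prFA_D : (prFA κ Φ t p D g f).D =
    TwoAxis.Para.detD (prFA κ Φ t p D g f).A (prFA κ Φ t p D g f).n (prFA κ Φ t p D g f).h (prFA κ Φ t p D g f).vα (prFA κ Φ t p D g f).vβ :=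
  rfl

/-- `0 < prFA.c₀`, `0 < prFA.c₁`. [folklore] -/
theorem prFA_c_pos : 0 < (prFA κ Φ t p D g f).c₀ ∧ 0 < (prFA κ Φ t p D g f).c₁ := ⟨cA_pos κ Φ t p D g f 0, cA_pos κ Φ t p D g f 1⟩

/-- **THE (ζ′) UNIT IDENTITY AT THE RECORD**: `prFA.c₀ = A·s₀`, `prFA.c₁ = A·s₁` — one lattice period per `s_i` cells. [this work] -/
theorem prFA_c_eq : (prFA κ Φ t p D g f).c₀ = (prFA κ Φ t p D g f).A * (((fcellsA κ Φ t p D g f).s 0 : ℕ) : ℤ) ∧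
    (prFA κ Φ t p D g f).c₁ = (prFA κ Φ t p D g f).A * (((fcellsA κ Φ t p D g f).s 1 : ℕ) : ℤ) :=
  ⟨c_eq_A_mul_s κ Φ t p D g f 0, c_eq_A_mul_s κ Φ t p D g f 1⟩

/-- **THE COLUMN CONSTANT OF RECORD OF THE (ζ′) CHAIN** `cOffA := A·(ℓ_L + 21·n_L + 1)` (`≥ A·max(L̂₀, L̂₁)`; `A = 20K`). [this work] -/
def cOffA : ℕ := 20 * Neg.K κ * (ℓL κ Φ t p D g f + 21 * nL κ Φ t p D g f + 1)

/-- `cOffA` as an integer: `A·(ℓ_L + 21 n_L + 1)`. [folklore] -/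
theorem cOffA_int : (cOffA κ Φ t p D g f : ℤ) = Aof κ * ((ℓL κ Φ t p D g f : ℤ) + 21 * nL κ Φ t p D g f + 1) := by
  unfold cOffA; rw [Aof_eq_K]; push_cast; ring

/-- **The representative at a cell centre is exact**: `rep₂ (cen x) = (A(x₀n_L + x₁v_L), A(x₀h_L + x₁v_β))`. [this work] -/
theorem rep₂_cenA_at (x : Site 2) :
    TwoAxis.Para.rep₂ (Aof κ) (nL κ Φ t p D g f) (hL κ Φ t p D g f) (vL κ Φ t p D g f) (vβL κ Φ t p D g f) (prFA κ Φ t p D g f).c₀ (prFA κ Φ t p D g f).c₁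
        ((fcellsA κ Φ t p D g f).cen x) 0 = Aof κ * (x 0 * nL κ Φ t p D g f + x 1 * vL κ Φ t p D g f) ∧
      TwoAxis.Para.rep₂ (Aof κ) (nL κ Φ t p D g f) (hL κ Φ t p D g f) (vL κ Φ t p D g f) (vβL κ Φ t p D g f) (prFA κ Φ t p D g f).c₀ (prFA κ Φ t p D g f).c₁
        ((fcellsA κ Φ t p D g f).cen x) 1 = Aof κ * (x 0 * hL κ Φ t p D g f + x 1 * vβL κ Φ t p D g f) :=
  TwoAxis.Para.rep₂_of_mul (prFA_c_pos κ Φ t p D g f).1 (prFA_c_pos κ Φ t p D g f).2 (PCells2.cen_eq_mul _ x 0) (PCells2.cen_eq_mul _ x 1)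

/-- **`NrepA (cen x) ≤ A·(L̂₁·|x₀| + L̂₀·|x₁|)`** (exact representative + triangle inequality). [this work] -/
theorem NrepA_cen_le (x : Site 2) :
    (NrepA κ Φ t p D g f ((fcellsA κ Φ t p D g f).cen x) : ℤ) ≤
      Aof κ * (Skelφ.NegPrm.L1hat (nL κ Φ t p D g f) (hL κ Φ t p D g f) * |x 0| +
        Skelφ.NegPrm.L0hat (nL κ Φ t p D g f) (hL κ Φ t p D g f) (ℓL κ Φ t p D g f) (vL κ Φ t p D g f) * |x 1|) := by
  obtain ⟨h0, h1⟩ := rep₂_cenA_at κ Φ t p D g f x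
  have hA : 0 < Aof κ := (Aof_pos κ).1
  unfold NrepA
  push_cast
  rw [show (20 * ((fcellsA κ Φ t p D g f).K : ℤ) * (((fcellsA κ Φ t p D g f).s 0 : ℕ) : ℤ)) = (prFA κ Φ t p D g f).c₀ from rfl,
    show (20 * ((fcellsA κ Φ t p D g f).K : ℤ) * (((fcellsA κ Φ t p D g f).s 1 : ℕ) : ℤ)) = (prFA κ Φ t p D g f).c₁ from rfl, h0, h1]
  unfold Skelφ.NegPrm.L1hat Skelφ.NegPrm.L0hat
  unfold vβL
  have hn : |(nL κ Φ t p D g f : ℤ)| = nL κ Φ t p D g f := abs_of_nonneg (by positivity)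
  have e0 : |Aof κ * (x 0 * (nL κ Φ t p D g f : ℤ) + x 1 * vL κ Φ t p D g f)| ≤ Aof κ * ((nL κ Φ t p D g f : ℤ) * |x 0| + |vL κ Φ t p D g f| * |x 1|) := by
    rw [abs_mul, abs_of_pos hA]
    refine mul_le_mul_of_nonneg_left ?_ hA.le
    calc |x 0 * (nL κ Φ t p D g f : ℤ) + x 1 * vL κ Φ t p D g f| ≤ |x 0 * (nL κ Φ t p D g f : ℤ)| + |x 1 * vL κ Φ t p D g f| := abs_add_le _ _
      _ = (nL κ Φ t p D g f : ℤ) * |x 0| + |vL κ Φ t p D g f| * |x 1| := by rw [abs_mul, abs_mul, hn]; ring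
  have e1 : |Aof κ * (x 0 * hL κ Φ t p D g f + x 1 * Skelφ.NegPrm.vβOf (nL κ Φ t p D g f) (hL κ Φ t p D g f) (ℓL κ Φ t p D g f) (vL κ Φ t p D g f))| ≤
      Aof κ * (|hL κ Φ t p D g f| * |x 0| + |Skelφ.NegPrm.vβOf (nL κ Φ t p D g f) (hL κ Φ t p D g f) (ℓL κ Φ t p D g f) (vL κ Φ t p D g f)| * |x 1|) := by
    rw [abs_mul, abs_of_pos hA]
    refine mul_le_mul_of_nonneg_left ?_ hA.le
    calc |x 0 * hL κ Φ t p D g f + x 1 * Skelφ.NegPrm.vβOf (nL κ Φ t p D g f) (hL κ Φ t p D g f) (ℓL κ Φ t p D g f) (vL κ Φ t p D g f)|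
        ≤ |x 0 * hL κ Φ t p D g f| + |x 1 * Skelφ.NegPrm.vβOf (nL κ Φ t p D g f) (hL κ Φ t p D g f) (ℓL κ Φ t p D g f) (vL κ Φ t p D g f)| := abs_add_le _ _
      _ = |hL κ Φ t p D g f| * |x 0| + |Skelφ.NegPrm.vβOf (nL κ Φ t p D g f) (hL κ Φ t p D g f) (ℓL κ Φ t p D g f) (vL κ Φ t p D g f)| * |x 1| := by
          rw [abs_mul, abs_mul]; ring
  have e : Aof κ * ((nL κ Φ t p D g f : ℤ) * |x 0| + |vL κ Φ t p D g f| * |x 1|) +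
      Aof κ * (|hL κ Φ t p D g f| * |x 0| + |Skelφ.NegPrm.vβOf (nL κ Φ t p D g f) (hL κ Φ t p D g f) (ℓL κ Φ t p D g f) (vL κ Φ t p D g f)| * |x 1|) =
      Aof κ * (((nL κ Φ t p D g f : ℤ) + |hL κ Φ t p D g f|) * |x 0| +
        (|Skelφ.NegPrm.vβOf (nL κ Φ t p D g f) (hL κ Φ t p D g f) (ℓL κ Φ t p D g f) (vL κ Φ t p D g f)| + |vL κ Φ t p D g f|) * |x 1|) := by ring
  linarith

/-- **THE LINEAR COLUMN BOUND (the (F) binder `hoff`)**: `offNA x ≤ cOffA·(|x₀| + |x₁|) + 1`, under the numeric long clause and `|h_L| ≤ 10·n_L`. [this work] -/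
theorem offNA_le (hN : EqNumL κ Φ t p D g f) (hκ : (hL κ Φ t p D g f).natAbs ≤ 10 * nL κ Φ t p D g f) (x : Site 2) :
    offNA κ Φ t p D g f x ≤ cOffA κ Φ t p D g f * ((x 0).natAbs + (x 1).natAbs) + 1 := by
  have h := NrepA_cen_le κ Φ t p D g f x
  have hL0 := L0hat_le κ Φ t p D g f hN hκ
  have hL1 := L1hat_le κ Φ t p D g f hκ
  have hA : 0 < Aof κ := (Aof_pos κ).1
  have hℓ0 : (0 : ℤ) ≤ ℓL κ Φ t p D g f := by positivity
  have hn0 : (0 : ℤ) ≤ nL κ Φ t p D g f := by positivity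
  have hL1' : Skelφ.NegPrm.L1hat (nL κ Φ t p D g f) (hL κ Φ t p D g f) ≤ (ℓL κ Φ t p D g f : ℤ) + 21 * nL κ Φ t p D g f + 1 := by linarith
  have hx0 := abs_nonneg (x 0)
  have hx1 := abs_nonneg (x 1)
  have key : (NrepA κ Φ t p D g f ((fcellsA κ Φ t p D g f).cen x) : ℤ) ≤ Aof κ * ((ℓL κ Φ t p D g f : ℤ) + 21 * nL κ Φ t p D g f + 1) * (|x 0| + |x 1|) := by
    have s1 : Skelφ.NegPrm.L1hat (nL κ Φ t p D g f) (hL κ Φ t p D g f) * |x 0| ≤ ((ℓL κ Φ t p D g f : ℤ) + 21 * nL κ Φ t p D g f + 1) * |x 0| :=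
      mul_le_mul_of_nonneg_right hL1' hx0
    have s0 : Skelφ.NegPrm.L0hat (nL κ Φ t p D g f) (hL κ Φ t p D g f) (ℓL κ Φ t p D g f) (vL κ Φ t p D g f) * |x 1| ≤
        ((ℓL κ Φ t p D g f : ℤ) + 21 * nL κ Φ t p D g f + 1) * |x 1| := mul_le_mul_of_nonneg_right hL0 hx1
    have s2 : Aof κ * (Skelφ.NegPrm.L1hat (nL κ Φ t p D g f) (hL κ Φ t p D g f) * |x 0| +
        Skelφ.NegPrm.L0hat (nL κ Φ t p D g f) (hL κ Φ t p D g f) (ℓL κ Φ t p D g f) (vL κ Φ t p D g f) * |x 1|) ≤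
        Aof κ * (((ℓL κ Φ t p D g f : ℤ) + 21 * nL κ Φ t p D g f + 1) * |x 0| + ((ℓL κ Φ t p D g f : ℤ) + 21 * nL κ Φ t p D g f + 1) * |x 1|) :=
      mul_le_mul_of_nonneg_left (by linarith) hA.le
    have e : Aof κ * (((ℓL κ Φ t p D g f : ℤ) + 21 * nL κ Φ t p D g f + 1) * |x 0| + ((ℓL κ Φ t p D g f : ℤ) + 21 * nL κ Φ t p D g f + 1) * |x 1|) =
        Aof κ * ((ℓL κ Φ t p D g f : ℤ) + 21 * nL κ Φ t p D g f + 1) * (|x 0| + |x 1|) := by ring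
    linarith
  unfold offNA
  have : (NrepA κ Φ t p D g f ((fcellsA κ Φ t p D g f).cen x) : ℤ) ≤ ((cOffA κ Φ t p D g f * ((x 0).natAbs + (x 1).natAbs) : ℕ) : ℤ) := by
    push_cast; rw [cOffA_int]; exact key
  have := Int.ofNat_le.1 this
  omega

/-- **The (F) binder `hoffN`**: `‖rep₂ prFA… (cen x)‖₁ + 1 ≤ offNA x` (by definition of `offNA`). [folklore] -/
theorem hoffNA_at (x : Site 2) :
    (TwoAxis.Para.rep₂ (prFA κ Φ t p D g f).A (prFA κ Φ t p D g f).n (prFA κ Φ t p D g f).h (prFA κ Φ t p D g f).vα (prFA κ Φ t p D g f).vβ (prFA κ Φ t p D g f).c₀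
          (prFA κ Φ t p D g f).c₁ ((fcellsA κ Φ t p D g f).cen x) 0).natAbs +
        (TwoAxis.Para.rep₂ (prFA κ Φ t p D g f).A (prFA κ Φ t p D g f).n (prFA κ Φ t p D g f).h (prFA κ Φ t p D g f).vα (prFA κ Φ t p D g f).vβ (prFA κ Φ t p D g f).c₀
          (prFA κ Φ t p D g f).c₁ ((fcellsA κ Φ t p D g f).cen x) 1).natAbs + 1 ≤ offNA κ Φ t p D g f x :=
  le_rfl

/-- **The (F) binders `hL0/hL1` at the record** (`c₀·L 0 + 2 ≤ D_A`, `c₁·L 1 + 2 ≤ D_A` in `FinePrm`'s vocabulary) from `room_fcellsA_at`. [folklore] -/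
theorem prFA_room (hN : EqNumL κ Φ t p D g f) :
    (prFA κ Φ t p D g f).c₀ * (prFA κ Φ t p D g f).L 0 + 2 ≤ (prFA κ Φ t p D g f).D ∧ (prFA κ Φ t p D g f).c₁ * (prFA κ Φ t p D g f).L 1 + 2 ≤ (prFA κ Φ t p D g f).D := by
  obtain ⟨h0, h1⟩ := room_fcellsA_at κ Φ t p D g f hN
  have e0 : (prFA κ Φ t p D g f).L 0 = |Aof κ| * (|vβL κ Φ t p D g f| + |vL κ Φ t p D g f|) := by
    unfold Skelφ.FinePrm.L Skelφ.FinePrm.lvGen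
    simp only [if_true, Matrix.cons_val_zero, Matrix.cons_val_one]
    rw [add_comm]; rfl
  have e1 : (prFA κ Φ t p D g f).L 1 = |Aof κ| * (|(nL κ Φ t p D g f : ℤ)| + |hL κ Φ t p D g f|) := by
    unfold Skelφ.FinePrm.L Skelφ.FinePrm.lvGen
    simp only [show ((1 : Fin 2) = 0) = False from propext ⟨fun h => absurd h (by decide), False.elim⟩, if_false, Matrix.cons_val_zero, Matrix.cons_val_one]
    rfl
  rw [e0, e1]
  exact ⟨h0, h1⟩

end Sched

end NegB

end PlanarSkeletonNeg

end Summit.CriticalPhenomena.PercolationContinuityZ3.Theorems.Transplant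

end
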